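import Literature.Computability.Cryptography.CliffordTPolyTimeEntries
import Literature.Computability.Complexity.PairPlumbing
import Literature.Computability.Complexity.FPStringBricks
import HarnessLib

/-!
# Polynomial-time computable real numbers form a ring (Ko 1991, §2)

Sibling proof file of `QuantumTuringMachine.lean`, which defines `IsPolyTimeComputableReal x`:
some `f : ℕ → ℤ`, polynomial-time computable from the unary numeral `1ⁿ` to the integer code
`encodingIntBool` (`TM2` machines, `PolyTimeComputable`), with `|x - f n / 2ⁿ| ≤ 2⁻ⁿ` for all `n`
(Ko 1991, Def. 2.1: a real is polynomial-time computable when a dyadic `2⁻ⁿ`-approximation is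
computable in time polynomial in `n`; Bernstein–Vazirani 1997, §6). `QuantumTuringMachineProofs.lean`
proves that rationals are such (`IsPolyTimeComputableReal.ratCast_holds`). This file proves the ring
closure properties — Ko 1991, Thm. 2.? ("the class `P_ℝ` of polynomial-time computable real numbers
is a real closed field"; the field and square-root parts are in `PolyTimeComputableRealsSqrt.lean`):

* the bridge between names and the `FP` string algebra (`IsPolyTimeComputableReal.nameFn_mem_FP`,
  `polyTimeComputable_of_nameFn`): a polynomial-time name `f` is the same thing as the string map
  `w ↦ code (f |w|)` in `FP`, so names are post-composed with the integer bricks of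
  `IntPairBricks.lean` / `ZIntBricks.lean` and pre-composed with `1ⁿ ↦ 1^{n+c}`, `1ⁿ ↦ 1^{2n}`;
* the rounding lemma `IsPolyTimeComputableReal.of_approx`: a polynomial-time `g` with
  `|x - g n / 2^{n+2}| ≤ 2^{-(n+1)}` already makes `x` polynomial-time (name `⌊(g n + 2)/4⌋`);
* closure under addition, subtraction, multiplication and powers (`.add`, `.sub`, `.mul`, `.pow`;
  negation `.neg` is in `CliffordTPolyTimeEntries.lean`), and the casts (`natCast`, `intCast`, `ofNat`).

The proofs are the textbook error bookkeeping (evaluate the given names at a shifted precision,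
combine with exact integer arithmetic, round), e.g. for the product: with `|x|, |y| ≤ 2^B` and
`m = n + B + 4`, `|xy − f₁(m) f₂(m)/4^m| ≤ 2^{B+2−m} = 2^{−n−2}`.

## References

* K.-I. Ko, *Complexity Theory of Real Functions*, Birkhäuser 1991, §2.1–§2.2 (Def. 2.1;
  closure of `P_ℝ` under the arithmetic operations) [Ko1991].
* E. Bernstein, U. Vazirani, *Quantum complexity theory*, SIAM J. Comput. 26 (1997), §6
  (polynomial-time computable amplitudes) [BernsteinVazirani1997].
* S. Arora, B. Barak, *Computational Complexity: A Modern Approach*, CUP 2009, §1.3 (polynomial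
  time is closed under composition) [AroraBarak2009].
-/

namespace Literature.Computability.Cryptography

open _root_.Computability Literature.Computability.Complexity
  Literature.Computability.Complexity.Brick Literature.Computability.Complexity.TimeConstructible

/-! ### Small facts about the codes -/

/-- `|1ⁿ| = n` (a private copy of the helper of `LiuPassWeakOWF.lean`, not importable here). [folklore] -/
@[simp] private theorem length_unaryEncodeNat_ptc (n : ℕ) : (unaryEncodeNat n).length = n := by
  rw [OracleCompose.unaryEncodeNat_eq_replicate, List.length_replicate]

/-- `1ᶜ ++ 1ⁿ = 1^{c + n}`. [folklore] -/
theorem ones_append_unaryEncodeNat (c n : ℕ) : ones c ++ unaryEncodeNat n = unaryEncodeNat (c + n) := by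
  rw [OracleCompose.unaryEncodeNat_eq_replicate, OracleCompose.unaryEncodeNat_eq_replicate, List.replicate_add]

/-- The integer code of a natural number: sign bit `false`, magnitude `bin m` (the code of `z` is the
sign–magnitude pair `⟨[z < 0], bin |z|⟩` by definition). [folklore] -/
theorem encodingIntBool_encode_natCast (m : ℕ) : encodingIntBool.encode (m : ℤ) = boolPair [false] (encodeNat m) := by
  have h : ¬ ((m : ℤ) < 0) := not_lt.2 (Int.natCast_nonneg m)
  change boolPair [decide ((m : ℤ) < 0)] (encodeNat (m : ℤ).natAbs) = _
  rw [Int.natAbs_natCast]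
  simp [h]

/-- `ofSMFn` converts the integer code to the canonical difference pair. [folklore] -/
@[simp] theorem ofSMFn_encodingIntBool (z : ℤ) : ofSMFn (encodingIntBool.encode z) = dpEnc z := ofSMFn_encode z

/-- `signMagOfZF` converts the canonical difference pair back to the integer code. [folklore] -/
@[simp] theorem signMagOfZF_dpEnc' (z : ℤ) : signMagOfZF (dpEnc z) = encodingIntBool.encode z := signMagOfZF_dpEnc z

/-- The canonical difference pair of a natural number is `⟨bin m, ε⟩`. [folklore] -/
theorem dpEnc_natCast (m : ℕ) : dpEnc (m : ℤ) = boolPair (encodeNat m) [] := by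
  unfold dpEnc
  rw [Int.toNat_natCast, Int.toNat_neg_natCast, TokConv.encodeNat_zero']

/-! ### Names and the `FP` string algebra -/

/-- **A polynomial-time name is an `FP` string map**: if `f : ℕ → ℤ` is polynomial-time from `1ⁿ`
to the integer code, then `w ↦ code (f |w|)` is in `FP` (precompose with `w ↦ 1^{|w|}`,
`onesFn_mem_FP`; `PolyTimeComputable.comp_holds`). [cite: AroraBarak2009, §1.3] -/
theorem IsPolyTimeComputableReal.nameFn_mem_FP {f : ℕ → ℤ}
    (hf : PolyTimeComputable unaryEncodeNat encodingIntBool.encode f) :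
    (fun w : List Bool => encodingIntBool.encode (f w.length)) ∈ FP := by
  have h1 : PolyTimeComputable (fun w : List Bool => w) unaryEncodeNat (fun w : List Bool => w.length) :=
    onesFn_mem_FP.of_encode (fun w => w) (fun _ => rfl) (fun _ => rfl)
  exact (PolyTimeComputable.comp_holds hf h1).of_encode (fun w => w) (fun _ => rfl) (fun _ => rfl)

/-- Conversely, an `FP` string map that sends `1ⁿ` to `code (a n)` is a polynomial-time name `a`.
[cite: AroraBarak2009, §1.3] -/
theorem polyTimeComputable_of_nameFn {a : ℕ → ℤ} {G : List Bool → List Bool} (hG : G ∈ FP)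
    (h : ∀ n, G (unaryEncodeNat n) = encodingIntBool.encode (a n)) :
    PolyTimeComputable unaryEncodeNat encodingIntBool.encode a :=
  hG.of_encode (g := unaryEncodeNat) (fun _ => rfl) h

/-- Shifting the precision: `n ↦ f (c + n)` is a polynomial-time name if `f` is. [cite: AroraBarak2009, §1.3] -/
theorem _root_.Literature.Computability.Complexity.PolyTimeComputable.unary_add_left {f : ℕ → ℤ} (hf : PolyTimeComputable unaryEncodeNat encodingIntBool.encode f)
    (c : ℕ) : PolyTimeComputable unaryEncodeNat encodingIntBool.encode (fun n => f (c + n)) := by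
  refine polyTimeComputable_of_nameFn
    (comp_mem_FP (IsPolyTimeComputableReal.nameFn_mem_FP hf) (append_mem_FP (const_mem_FP (ones c)) OracleCompose.id_mem_FP))
    fun n => ?_
  simp [ones_append_unaryEncodeNat]

/-- Doubling the precision: `n ↦ f (c + 2n)` is a polynomial-time name if `f` is. [cite: AroraBarak2009, §1.3] -/
theorem _root_.Literature.Computability.Complexity.PolyTimeComputable.unary_add_two_mul {f : ℕ → ℤ} (hf : PolyTimeComputable unaryEncodeNat encodingIntBool.encode f)
    (c : ℕ) : PolyTimeComputable unaryEncodeNat encodingIntBool.encode (fun n => f (c + 2 * n)) := by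
  refine polyTimeComputable_of_nameFn
    (comp_mem_FP (IsPolyTimeComputableReal.nameFn_mem_FP hf)
      (append_mem_FP (const_mem_FP (ones c)) (append_mem_FP OracleCompose.id_mem_FP OracleCompose.id_mem_FP)))
    fun n => ?_
  have e : unaryEncodeNat n ++ unaryEncodeNat n = unaryEncodeNat (2 * n) := by
    rw [OracleCompose.unaryEncodeNat_eq_replicate, OracleCompose.unaryEncodeNat_eq_replicate, two_mul, List.replicate_add]
  simp only [Function.comp_apply, id, e, ones_append_unaryEncodeNat, length_unaryEncodeNat_ptc]

/-! ### Rounding: a coarser approximation at a finer scale suffices -/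

/-- `|a/4 - ⌊(a + 2)/4⌋| ≤ 1/2` (rounding to the nearest integer by a floor division). [folklore] -/
theorem abs_div_four_sub_round_le (a : ℤ) : |(a : ℝ) / 4 - (((a + 2) / 4 : ℤ) : ℝ)| ≤ 1 / 2 := by
  have h := Int.mul_ediv_add_emod (a + 2) 4
  have h0 := Int.emod_nonneg (a + 2) (by norm_num : (4 : ℤ) ≠ 0)
  have h4 := Int.emod_lt_of_pos (a + 2) (by norm_num : (0 : ℤ) < 4)
  have ha : (a : ℝ) = 4 * (((a + 2) / 4 : ℤ) : ℝ) + (((a + 2) % 4 : ℤ) : ℝ) - 2 := by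
    have : a = 4 * ((a + 2) / 4) + (a + 2) % 4 - 2 := by omega
    exact_mod_cast this
  have h0' : (0 : ℝ) ≤ (((a + 2) % 4 : ℤ) : ℝ) := by exact_mod_cast h0
  have h4' : (((a + 2) % 4 : ℤ) : ℝ) ≤ 3 := by
    have : (a + 2) % 4 ≤ 3 := by omega
    exact_mod_cast this
  rw [ha, abs_le]
  constructor <;> linarith

/-- **Rounding lemma.** If a polynomial-time `g` satisfies `|x - g n / 2^{n+2}| ≤ 2^{-(n+1)}` for all
`n`, then `x` is polynomial-time computable, with the name `n ↦ ⌊(g n + 2)/4⌋`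
(`|x - ⌊(g n + 2)/4⌋/2ⁿ| ≤ 2^{-(n+1)} + 2^{-n}/2 = 2^{-n}`); the name is `g` post-composed with the
integer bricks `zaddF`, `zedivF`. [cite: Ko1991, §2.1] -/
theorem IsPolyTimeComputableReal.of_approx {x : ℝ} (g : ℕ → ℤ)
    (hg : PolyTimeComputable unaryEncodeNat encodingIntBool.encode g)
    (happrox : ∀ n, |x - (g n : ℝ) / 2 ^ (n + 2)| ≤ (1 / 2 : ℝ) ^ (n + 1)) :
    IsPolyTimeComputableReal x := by
  refine ⟨fun n => (g n + 2) / 4, ?_, fun n => ?_⟩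
  · refine polyTimeComputable_of_nameFn
      (comp_mem_FP signMagOfZF_mem_FP (comp_mem_FP zedivF_mem_FP (fanoutFn_mem_FP
        (comp_mem_FP zaddF_mem_FP (fanoutFn_mem_FP (comp_mem_FP ofSMFn_mem_FP (nameFn_mem_FP hg)) (const_mem_FP (dpEnc 2))))
        (const_mem_FP (dpEnc 4))))) fun n => ?_
    simp only [Function.comp_apply, fanoutFn_apply, length_unaryEncodeNat_ptc, ofSMFn_encodingIntBool, zaddF_boolPair,
      ival_dpEnc, zedivF_dpEnc, signMagOfZF_dpEnc']
  · have h1 := happrox n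
    have h2 := abs_div_four_sub_round_le (g n)
    have e : x - (((g n + 2) / 4 : ℤ) : ℝ) / 2 ^ n =
        (x - (g n : ℝ) / 2 ^ (n + 2)) + ((g n : ℝ) / 4 - (((g n + 2) / 4 : ℤ) : ℝ)) / 2 ^ n := by
      rw [pow_add]; ring
    rw [e]
    refine (abs_add_le _ _).trans ?_
    rw [abs_div, abs_of_pos (pow_pos (by norm_num : (0 : ℝ) < 2) n)]
    have h3 : |(g n : ℝ) / 4 - (((g n + 2) / 4 : ℤ) : ℝ)| / 2 ^ n ≤ (1 / 2) / 2 ^ n :=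
      div_le_div_of_nonneg_right h2 (pow_pos (by norm_num) n).le
    have e2 : (1 / 2 : ℝ) ^ (n + 1) + (1 / 2) / 2 ^ n = (1 / 2 : ℝ) ^ n := by
      rw [one_div_pow, one_div_pow]; field_simp; ring
    calc _ ≤ (1 / 2 : ℝ) ^ (n + 1) + (1 / 2) / 2 ^ n := add_le_add h1 h3
      _ = (1 / 2 : ℝ) ^ n := e2

/-! ### Casts -/

/-- Natural numbers are polynomial-time computable reals. [cite: Ko1991, §2.1] -/
theorem IsPolyTimeComputableReal.natCast (m : ℕ) : IsPolyTimeComputableReal (m : ℝ) := by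
  simpa using IsPolyTimeComputableReal.ratCast_holds (m : ℚ)

/-- Integers are polynomial-time computable reals. [cite: Ko1991, §2.1] -/
theorem IsPolyTimeComputableReal.intCast (z : ℤ) : IsPolyTimeComputableReal (z : ℝ) := by
  simpa using IsPolyTimeComputableReal.ratCast_holds (z : ℚ)

/-- Numerals are polynomial-time computable reals. [cite: Ko1991, §2.1] -/
theorem IsPolyTimeComputableReal.ofNat (m : ℕ) [m.AtLeastTwo] : IsPolyTimeComputableReal (OfNat.ofNat m : ℝ) :=
  IsPolyTimeComputableReal.natCast m

/-! ### Addition, subtraction (negation is `IsPolyTimeComputableReal.neg`, `CliffordTPolyTimeEntries.lean`) -/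

/-- **`P_ℝ` is closed under addition**: `g n = f₁ (n+2) + f₂ (n+2)` has
`|x + y - g n/2^{n+2}| ≤ 2 · 2^{-(n+2)}`, and the rounding lemma applies. [cite: Ko1991, §2.2] -/
theorem IsPolyTimeComputableReal.add {x y : ℝ} (hx : IsPolyTimeComputableReal x) (hy : IsPolyTimeComputableReal y) :
    IsPolyTimeComputableReal (x + y) := by
  obtain ⟨f₁, hf₁, hb₁⟩ := hx
  obtain ⟨f₂, hf₂, hb₂⟩ := hy
  refine IsPolyTimeComputableReal.of_approx (fun n => f₁ (2 + n) + f₂ (2 + n)) ?_ fun n => ?_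
  · refine polyTimeComputable_of_nameFn
      (comp_mem_FP signMagOfZF_mem_FP (comp_mem_FP zaddF_mem_FP (fanoutFn_mem_FP
        (comp_mem_FP ofSMFn_mem_FP (nameFn_mem_FP (hf₁.unary_add_left 2)))
        (comp_mem_FP ofSMFn_mem_FP (nameFn_mem_FP (hf₂.unary_add_left 2)))))) fun n => ?_
    simp only [Function.comp_apply, fanoutFn_apply, length_unaryEncodeNat_ptc, ofSMFn_encodingIntBool, zaddF_boolPair,
      ival_dpEnc, signMagOfZF_dpEnc']
  · have h1 := hb₁ (2 + n)
    have h2 := hb₂ (2 + n)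
    have e : x + y - ((f₁ (2 + n) + f₂ (2 + n) : ℤ) : ℝ) / 2 ^ (n + 2) =
        (x - (f₁ (2 + n) : ℝ) / 2 ^ (2 + n)) + (y - (f₂ (2 + n) : ℝ) / 2 ^ (2 + n)) := by
      rw [add_comm n 2]; push_cast; ring
    rw [e]
    refine (abs_add_le _ _).trans ?_
    have e2 : (1 / 2 : ℝ) ^ (2 + n) + (1 / 2 : ℝ) ^ (2 + n) = (1 / 2 : ℝ) ^ (n + 1) := by
      rw [add_comm 2 n, pow_succ]; ring
    calc _ ≤ (1 / 2 : ℝ) ^ (2 + n) + (1 / 2 : ℝ) ^ (2 + n) := add_le_add h1 h2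
      _ = _ := e2

/-- **`P_ℝ` is closed under subtraction.** [cite: Ko1991, §2.2] -/
theorem IsPolyTimeComputableReal.sub {x y : ℝ} (hx : IsPolyTimeComputableReal x) (hy : IsPolyTimeComputableReal y) :
    IsPolyTimeComputableReal (x - y) := by
  simpa [sub_eq_add_neg] using hx.add hy.neg

/-! ### Multiplication -/

/-- Every real number is bounded by a power of two. [folklore] -/
theorem exists_abs_le_two_pow (x : ℝ) : ∃ B : ℕ, |x| ≤ 2 ^ B := by
  obtain ⟨B, hB⟩ := exists_nat_gt |x|
  refine ⟨B, hB.le.trans ?_⟩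
  exact_mod_cast (Nat.lt_two_pow_self (n := B)).le

/-- A name stays within `1` of the scaled number: `|f m| ≤ 2^m |x| + 1`. [folklore] -/
theorem IsPolyTimeComputableReal.abs_name_le {x : ℝ} {f : ℕ → ℤ} (hb : ∀ n, |x - (f n : ℝ) / 2 ^ n| ≤ (1 / 2 : ℝ) ^ n)
    (m : ℕ) : |(f m : ℝ)| ≤ 2 ^ m * |x| + 1 := by
  have h := hb m
  have h2m : (0 : ℝ) < 2 ^ m := pow_pos (by norm_num) m
  have e : (f m : ℝ) = 2 ^ m * x - 2 ^ m * (x - (f m : ℝ) / 2 ^ m) := by field_simp; ring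
  rw [e]
  refine (abs_sub _ _).trans ?_
  rw [abs_mul, abs_mul, abs_of_pos h2m]
  have : 2 ^ m * |x - (f m : ℝ) / 2 ^ m| ≤ 1 := by
    calc 2 ^ m * |x - (f m : ℝ) / 2 ^ m| ≤ 2 ^ m * (1 / 2 : ℝ) ^ m := mul_le_mul_of_nonneg_left h h2m.le
      _ = 1 := by rw [one_div_pow, mul_one_div_cancel h2m.ne']
  linarith

/-- The product error: if `|x|, |y| ≤ 2^B`, `|x - a/2^m|, |y - b/2^m| ≤ 2^{-m}` then
`|xy - ab/4^m| ≤ (2^{B+1} + 1) 2^{-m}`. [folklore] -/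
theorem abs_mul_sub_mul_div_le {x y a b : ℝ} {B m : ℕ} (hx : |x| ≤ 2 ^ B) (hy : |y| ≤ 2 ^ B)
    (ha : |x - a / 2 ^ m| ≤ (1 / 2 : ℝ) ^ m) (hb : |y - b / 2 ^ m| ≤ (1 / 2 : ℝ) ^ m) :
    |x * y - a * b / (2 ^ m * 2 ^ m)| ≤ (2 ^ (B + 1) + 1) * (1 / 2 : ℝ) ^ m := by
  have h2m : (0 : ℝ) < 2 ^ m := pow_pos (by norm_num) m
  have e : x * y - a * b / (2 ^ m * 2 ^ m) = x * (y - b / 2 ^ m) + (b / 2 ^ m) * (x - a / 2 ^ m) := by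
    field_simp; ring
  rw [e]
  refine (abs_add_le _ _).trans ?_
  rw [abs_mul, abs_mul]
  have hb' : |b / 2 ^ m| ≤ 2 ^ B + 1 := by
    have : |b / 2 ^ m| ≤ |y| + |y - b / 2 ^ m| := by
      have h := abs_sub y (y - b / 2 ^ m)
      rwa [sub_sub_cancel] at h
    refine this.trans ?_
    have h1 : (1 / 2 : ℝ) ^ m ≤ 1 := pow_le_one₀ (by norm_num) (by norm_num)
    linarith
  have hp : (0 : ℝ) ≤ (1 / 2 : ℝ) ^ m := by positivity
  calc |x| * |y - b / 2 ^ m| + |b / 2 ^ m| * |x - a / 2 ^ m|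
      ≤ 2 ^ B * (1 / 2 : ℝ) ^ m + (2 ^ B + 1) * (1 / 2 : ℝ) ^ m :=
        add_le_add (mul_le_mul hx hb (abs_nonneg _) (by positivity)) (mul_le_mul hb' ha (abs_nonneg _) (by positivity))
    _ = (2 ^ (B + 1) + 1) * (1 / 2 : ℝ) ^ m := by rw [pow_succ]; ring

/-- Floor division by a positive integer is within `1`: `|p/d - ⌊p/d⌋| < 1`. [folklore] -/
theorem abs_div_sub_ediv_lt (p : ℤ) {d : ℤ} (hd : 0 < d) : |(p : ℝ) / d - ((p / d : ℤ) : ℝ)| < 1 := by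
  have h := Int.mul_ediv_add_emod p d
  have h0 := Int.emod_nonneg p hd.ne'
  have h1 := Int.emod_lt_of_pos p hd
  have hdR : (0 : ℝ) < d := by exact_mod_cast hd
  have e : (p : ℝ) / d - ((p / d : ℤ) : ℝ) = ((p % d : ℤ) : ℝ) / d := by
    have hp : (p : ℝ) = d * ((p / d : ℤ) : ℝ) + ((p % d : ℤ) : ℝ) := by exact_mod_cast h.symm
    rw [hp]; field_simp; ring
  rw [e, abs_div, abs_of_pos hdR, div_lt_one hdR, abs_of_nonneg (by exact_mod_cast h0)]
  exact_mod_cast h1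

/-- **`P_ℝ` is closed under multiplication**: with `|x|, |y| ≤ 2^B` and `m = n + B + 4`, the integer
`g n = ⌊f₁(m) f₂(m) / 2^{n+2B+6}⌋` satisfies `|xy - g n/2^{n+2}| ≤ 2^{-(n+2)} + 2^{-(n+2)}`, and the
rounding lemma applies; `g` is the names post-composed with `zmulF`, `zedivF` and the power brick
`powFn 1`. [cite: Ko1991, §2.2] -/
theorem IsPolyTimeComputableReal.mul {x y : ℝ} (hx : IsPolyTimeComputableReal x) (hy : IsPolyTimeComputableReal y) :
    IsPolyTimeComputableReal (x * y) := by
  obtain ⟨f₁, hf₁, hb₁⟩ := hx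
  obtain ⟨f₂, hf₂, hb₂⟩ := hy
  obtain ⟨B₁, hB₁⟩ := exists_abs_le_two_pow x
  obtain ⟨B₂, hB₂⟩ := exists_abs_le_two_pow y
  -- a common bound `2^B`
  set B := max B₁ B₂ with hB
  have hxB : |x| ≤ 2 ^ B := hB₁.trans (pow_le_pow_right₀ (by norm_num) (le_max_left _ _))
  have hyB : |y| ≤ 2 ^ B := hB₂.trans (pow_le_pow_right₀ (by norm_num) (le_max_right _ _))
  refine IsPolyTimeComputableReal.of_approx
    (fun n => f₁ (B + 4 + n) * f₂ (B + 4 + n) / 2 ^ (2 * B + 6 + n)) ?_ fun n => ?_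
  · -- the string map: multiply the shifted names, divide by the power of two
    refine polyTimeComputable_of_nameFn
      (comp_mem_FP signMagOfZF_mem_FP (comp_mem_FP zedivF_mem_FP (fanoutFn_mem_FP
        (comp_mem_FP zmulF_mem_FP (fanoutFn_mem_FP
          (comp_mem_FP ofSMFn_mem_FP (nameFn_mem_FP (hf₁.unary_add_left (B + 4))))
          (comp_mem_FP ofSMFn_mem_FP (nameFn_mem_FP (hf₂.unary_add_left (B + 4))))))
        (fanoutFn_mem_FP (comp_mem_FP (powFn_mem_FP 1) (append_mem_FP (const_mem_FP (ones (2 * B + 6))) OracleCompose.id_mem_FP))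
          (const_mem_FP []))))) fun n => ?_
    simp only [Function.comp_apply, fanoutFn_apply, length_unaryEncodeNat_ptc, ofSMFn_encodingIntBool, zmulF_boolPair,
      ival_dpEnc, id, ones_append_unaryEncodeNat, powFn_unary, pow_one]
    rw [← dpEnc_natCast, zedivF_dpEnc, signMagOfZF_dpEnc', Nat.cast_pow, Nat.cast_ofNat]
  · -- the error bound
    set m := B + 4 + n with hm
    have h1 := abs_mul_sub_mul_div_le (m := m) hxB hyB (hb₁ m) (hb₂ m)
    have hd : (0 : ℤ) < 2 ^ (2 * B + 6 + n) := pow_pos (by norm_num) _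
    have h2 := abs_div_sub_ediv_lt (f₁ m * f₂ m) hd
    have h2n : (0 : ℝ) < 2 ^ (n + 2) := pow_pos (by norm_num) _
    -- `ab/4^m = (ab / 2^{2B+6+n}) / 2^{n+2}`
    have e : x * y - ((f₁ m * f₂ m / 2 ^ (2 * B + 6 + n) : ℤ) : ℝ) / 2 ^ (n + 2) =
        (x * y - (f₁ m : ℝ) * f₂ m / (2 ^ m * 2 ^ m)) +
          (((f₁ m * f₂ m : ℤ) : ℝ) / ((2 ^ (2 * B + 6 + n) : ℤ) : ℝ) - ((f₁ m * f₂ m / 2 ^ (2 * B + 6 + n) : ℤ) : ℝ)) / 2 ^ (n + 2) := by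
      have e4 : (2 : ℝ) ^ m * 2 ^ m = 2 ^ (2 * B + 6 + n) * 2 ^ (n + 2) := by
        rw [← pow_add, ← pow_add]; congr 1; omega
      push_cast
      rw [e4]
      field_simp
      ring
    rw [e]
    refine (abs_add_le _ _).trans ?_
    rw [abs_div _ ((2 : ℝ) ^ (n + 2)), abs_of_pos h2n]
    have h3 : |((f₁ m * f₂ m : ℤ) : ℝ) / ((2 ^ (2 * B + 6 + n) : ℤ) : ℝ) - ((f₁ m * f₂ m / 2 ^ (2 * B + 6 + n) : ℤ) : ℝ)| /
        2 ^ (n + 2) ≤ 1 / 2 ^ (n + 2) := div_le_div_of_nonneg_right h2.le h2n.le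
    have h4 : (2 ^ (B + 1) + 1) * (1 / 2 : ℝ) ^ m ≤ 1 / 2 ^ (n + 2) := by
      have hm' : (2 : ℝ) ^ m = 2 ^ (B + 2) * 2 ^ (n + 2) := by
        rw [← pow_add]; congr 1; omega
      have hle : ((2 : ℝ) ^ (B + 1) + 1) / 2 ^ (B + 2) ≤ 1 := by
        rw [div_le_one (pow_pos (by norm_num) _), pow_succ _ (B + 1)]
        have : (1 : ℝ) ≤ 2 ^ (B + 1) := one_le_pow₀ (by norm_num)
        linarith
      calc (2 ^ (B + 1) + 1) * (1 / 2 : ℝ) ^ m = ((2 : ℝ) ^ (B + 1) + 1) / 2 ^ (B + 2) * (1 / 2 ^ (n + 2)) := by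
            rw [one_div_pow, hm']; ring
        _ ≤ 1 * (1 / 2 ^ (n + 2)) := mul_le_mul_of_nonneg_right hle (by positivity)
        _ = 1 / 2 ^ (n + 2) := one_mul _
    have e2 : 1 / 2 ^ (n + 2) + 1 / 2 ^ (n + 2) = (1 / 2 : ℝ) ^ (n + 1) := by
      rw [one_div_pow, pow_succ _ (n + 1)]; ring
    calc _ ≤ 1 / 2 ^ (n + 2) + 1 / 2 ^ (n + 2) := add_le_add (h1.trans h4) h3
      _ = _ := e2

/-- Powers of a polynomial-time computable real are polynomial-time computable. [cite: Ko1991, §2.2] -/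
theorem IsPolyTimeComputableReal.pow {x : ℝ} (hx : IsPolyTimeComputableReal x) (k : ℕ) : IsPolyTimeComputableReal (x ^ k) := by
  induction k with
  | zero => simpa using isPolyTimeComputableReal_one
  | succ k ih => rw [pow_succ]; exact ih.mul hx

end Literature.Computability.Cryptography
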